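import Literature.Analysis.FunctionSpaces.PoincareWirtingerConvex
import Mathlib.MeasureTheory.Measure.WithDensity
import HarnessLib

/-!
# Moser's weighted Poincaré inequality (quasi-concave weights on convex sets)

Analysis/FunctionSpaces proofs file (theorems only), companion of `PoincareWirtingerConvex`
(the unweighted Poincaré–Wirtinger inequality on convex sets by the segment argument). For a
`C¹` map `G : E → F`, a convex measurable set `Q ⊆ E` of finite Haar measure and diameter `≤ D`,
and a measurable weight `ω : E → [0, W]` vanishing off `Q` whose superlevel sets meet every
segment of `Q` in an interval (`min (ω y) (ω z) ≤ ω (z + τ(y − z))`, e.g. `ω` radially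
non-increasing on a ball), with `ν = ω dμ` and `G_ω = ⨍ G dν` the weighted average,

`∫ ‖G − G_ω‖² ω dμ ≤ 2ⁿ D² W μ(Q) (∫ ω dμ)⁻¹ ∫ ‖DG‖² ω dμ`, `n = dim E`

(`lintegral_enorm_sub_average_sq_le_of_quasiconcave_weight`). This is **Moser's lemma**
(J. Moser, *A Harnack inequality for parabolic differential equations*, CPAM 17 (1964),
Lemma 3; Lieberman, *Second Order Parabolic Differential Equations* (1996), Lemma 6.12;
Saloff-Coste, *Aspects of Sobolev-type inequalities* (2002), Thm. 5.3.4), the weighted Poincaré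
inequality of every Nash–Moser argument for the logarithm of a positive supersolution; in
particular it is inequality (3.4) of Lei–Zhang, J. Funct. Anal. 261 (2011) = arXiv:1011.5066,
p. 9 ("`∫ |Ψ − Ψ̄|² ζ² dx ≤ C ∫ |∇Ψ|² ζ² dx`", `Ψ̄ = ∫ Ψ ζ²`, `∫ ζ² = 1`, `ζ` a radial cut-off),
an ingredient of step 1 of the printed proof of their Theorem 1.2 (the tree's named fact
`LeiZhang2011_liouville`).

Proof: the segment argument of `PoincareWirtingerConvex` with the extra remark
`ω(y) ω(z) ≤ W min(ω(y), ω(z)) ≤ W ω(z + τ(y − z))`: Cauchy–Schwarz against the `ν`-average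
(`enorm_sub_setAverage_sq_le` for the finite measure `ν`), the fundamental theorem of calculus
along segments (`enorm_sub_sq_le_lintegral_fderiv_segment`), and the scaled-segment
substitution (`setLIntegral_setLIntegral_comp_segment_le`) applied to `ω ‖DG‖²`.

## References

* J. Moser, *A Harnack inequality for parabolic differential equations*, Comm. Pure Appl.
  Math. 17 (1964) 101–134, Lemma 3 (Lieberman's reference [262]).
* G. M. Lieberman, *Second Order Parabolic Differential Equations* (1996), Lemma 6.12.
  [Lieberman1996]
* Z. Lei, Q. S. Zhang, J. Funct. Anal. 261 (2011) = arXiv:1011.5066, (3.4) p. 9. [LeiZhang2011]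
-/

noncomputable section

open Set Function Filter MeasureTheory MeasureTheory.Measure Module
open scoped ENNReal NNReal Topology

namespace Literature.Analysis.FunctionSpaces

variable {E : Type*} [NormedAddCommGroup E] [NormedSpace ℝ E] [MeasurableSpace E] [BorelSpace E]
  [FiniteDimensional ℝ E]
variable {F : Type*} [NormedAddCommGroup F] [NormedSpace ℝ F] [CompleteSpace F]
variable (μ : Measure E) [IsAddHaarMeasure μ]

/-- **Moser's weighted Poincaré inequality** (Moser 1964, Lemma 3; Lieberman 1996, Lemma 6.12;
Lei–Zhang 2011, (3.4)). Let `G ∈ C¹(E; F)`, `Q ⊆ E` convex measurable with `μ Q < ∞` and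
diameter `≤ D`, and `ω : E → ℝ≥0∞` a measurable weight with `ω ≤ W < ∞`, `ω = 0` off `Q`,
`∫ ω dμ ≠ 0`, quasi-concave along segments of `Q` (`min (ω y) (ω z) ≤ ω (z + τ • (y − z))` for
`y, z ∈ Q`, `τ ∈ [0,1]`), and `G` integrable for `ν = μ.withDensity ω`. Then
`∫ ‖G − ⨍ G dν‖² dν ≤ 2ⁿ D² W μ(Q) (∫ ω dμ)⁻¹ ∫ ‖DG‖² dν`, `n = dim E`. [cite: Lieberman1996, Lemma 6.12; LeiZhang2011, (3.4) (arXiv p. 9)] -/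
theorem lintegral_enorm_sub_average_sq_le_of_quasiconcave_weight {G : E → F}
    (hG : ContDiff ℝ 1 G) {Q : Set E} (hQ : Convex ℝ Q) (hQm : MeasurableSet Q) (hQt : μ Q ≠ ∞)
    {ω : E → ℝ≥0∞} (hωm : Measurable ω) (hωQ : ∀ x, x ∉ Q → ω x = 0) {W : ℝ≥0∞} (hW : W ≠ ∞)
    (hωW : ∀ x, ω x ≤ W)
    (hqc : ∀ y ∈ Q, ∀ z ∈ Q, ∀ τ ∈ Icc (0 : ℝ) 1, min (ω y) (ω z) ≤ ω (z + τ • (y - z)))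
    (hω0 : ∫⁻ x, ω x ∂μ ≠ 0) (hGi : Integrable G (μ.withDensity ω)) {D : ℝ}
    (hD : ∀ y ∈ Q, ∀ z ∈ Q, ‖y - z‖ ≤ D) :
    ∫⁻ y, ‖G y - ⨍ z, G z ∂(μ.withDensity ω)‖ₑ ^ 2 ∂(μ.withDensity ω) ≤
      ENNReal.ofReal (2 ^ finrank ℝ E * D ^ 2) * W * μ Q * (∫⁻ x, ω x ∂μ)⁻¹ *
        ∫⁻ y, ‖fderiv ℝ G y‖ₑ ^ 2 ∂(μ.withDensity ω) := by
  set ν : Measure E := μ.withDensity ω with hν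
  set φ : E → ℝ≥0∞ := fun w => ‖fderiv ℝ G w‖ₑ ^ 2 with hφ
  set ψ : E → ℝ≥0∞ := fun w => ω w * φ w with hψ
  have hφm : Measurable φ := (hG.continuous_fderiv one_ne_zero).measurable.enorm.pow_const _
  have hψm : Measurable ψ := hωm.mul hφm
  have hGc : Continuous G := hG.continuous
  -- the total mass of `ν`
  have hsupp : support ω ⊆ Q := fun x hx => by_contra fun hxQ => hx (hωQ x hxQ)
  have hνuniv : ν univ = ∫⁻ x, ω x ∂μ := by
    rw [hν, withDensity_apply _ MeasurableSet.univ, Measure.restrict_univ]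
  have hmass_le : ∫⁻ x, ω x ∂μ ≤ W * μ Q := by
    calc ∫⁻ x, ω x ∂μ = ∫⁻ x in Q, ω x ∂μ := (setLIntegral_eq_of_support_subset hsupp).symm
      _ ≤ ∫⁻ _ in Q, W ∂μ := lintegral_mono fun x => hωW x
      _ = W * μ Q := by rw [setLIntegral_const]
  have hνtop : ν univ ≠ ∞ := by
    rw [hνuniv]; exact ne_top_of_le_ne_top (ENNReal.mul_ne_top hW hQt) hmass_le
  have hν0 : ν univ ≠ 0 := by rwa [hνuniv]
  haveI : IsFiniteMeasure ν := ⟨hνtop.lt_top⟩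
  -- Step 1: Cauchy–Schwarz against the `ν`-average, integrated in `y`
  have h1 : ∫⁻ y, ‖G y - ⨍ z, G z ∂ν‖ₑ ^ 2 ∂ν ≤
      (ν univ)⁻¹ * ∫⁻ y, ∫⁻ z, ‖G y - G z‖ₑ ^ 2 ∂ν ∂ν := by
    rw [← lintegral_const_mul' _ _ (ENNReal.inv_ne_top.2 hν0)]
    refine lintegral_mono fun y => ?_
    have h := enorm_sub_setAverage_sq_le ν (Q := univ) hν0 hνtop hGi.integrableOn
      hGc.aestronglyMeasurable y
    simpa only [Measure.restrict_univ] using h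
  -- Step 2: the double `ν`-integral as a weighted double `μ`-integral over `Q × Q`
  have hmz : ∀ y, Measurable fun z => ‖G y - G z‖ₑ ^ 2 := fun y =>
    (continuous_const.sub hGc).enorm.measurable.pow_const _
  have hin : ∀ y, ∫⁻ z, ‖G y - G z‖ₑ ^ 2 ∂ν = ∫⁻ z in Q, ω z * ‖G y - G z‖ₑ ^ 2 ∂μ := by
    intro y
    rw [hν, lintegral_withDensity_eq_lintegral_mul μ hωm (hmz y)]
    refine (setLIntegral_eq_of_support_subset fun z hz => ?_).symm
    exact hsupp fun h0 => hz (by simp [h0])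
  have hmyz : Measurable (uncurry fun y z : E => ω z * ‖G y - G z‖ₑ ^ 2) :=
    (hωm.comp measurable_snd).mul
      (((hGc.comp continuous_fst).sub (hGc.comp continuous_snd)).enorm.measurable.pow_const _)
  have hmy : Measurable fun y => ∫⁻ z in Q, ω z * ‖G y - G z‖ₑ ^ 2 ∂μ :=
    (hmyz.lintegral_prod_right (ν := μ.restrict Q))
  have h2 : ∫⁻ y, ∫⁻ z, ‖G y - G z‖ₑ ^ 2 ∂ν ∂ν =
      ∫⁻ y in Q, ω y * ∫⁻ z in Q, ω z * ‖G y - G z‖ₑ ^ 2 ∂μ ∂μ := by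
    simp_rw [hin]
    rw [hν, lintegral_withDensity_eq_lintegral_mul μ hωm hmy]
    refine (setLIntegral_eq_of_support_subset fun y hy => ?_).symm
    exact hsupp fun h0 => hy (by simp [h0])
  -- Step 3: the weighted segment estimate, for `y, z ∈ Q`
  have hseg : ∀ y ∈ Q, ∀ z ∈ Q, ω y * (ω z * ‖G y - G z‖ₑ ^ 2) ≤
      ENNReal.ofReal (D ^ 2) * W * ∫⁻ τ in Icc (0 : ℝ) 1, ψ (z + τ • (y - z)) := by
    intro y hy z hz
    have hs := enorm_sub_sq_le_lintegral_fderiv_segment hG (hD y hy z hz)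
    have hmτ : Measurable fun τ : ℝ => φ (z + τ • (y - z)) := hφm.comp (by fun_prop)
    -- `ω y ω z ≤ W ω(z + τ(y - z))`
    have hprod : ∀ τ ∈ Icc (0 : ℝ) 1, ω y * ω z ≤ W * ω (z + τ • (y - z)) := by
      intro τ hτ
      have hmin := hqc y hy z hz τ hτ
      rcases le_total (ω y) (ω z) with h | h
      · rw [min_eq_left h] at hmin
        calc ω y * ω z ≤ ω (z + τ • (y - z)) * W := mul_le_mul' hmin (hωW z)
          _ = W * ω (z + τ • (y - z)) := mul_comm _ _
      · rw [min_eq_right h] at hmin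
        exact mul_le_mul' (hωW y) hmin
    have hmψτ : Measurable fun τ : ℝ => ψ (z + τ • (y - z)) := hψm.comp (by fun_prop)
    have hpt : ∀ τ ∈ Icc (0 : ℝ) 1,
        ω y * ω z * φ (z + τ • (y - z)) ≤ W * ψ (z + τ • (y - z)) := fun τ hτ =>
      (mul_le_mul_left (hprod τ hτ) _).trans_eq (mul_assoc _ _ _)
    have hI : ∫⁻ τ in Icc (0 : ℝ) 1, ω y * ω z * φ (z + τ • (y - z)) ≤
        W * ∫⁻ τ in Icc (0 : ℝ) 1, ψ (z + τ • (y - z)) := by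
      rw [← lintegral_const_mul _ hmψτ]
      exact setLIntegral_mono' measurableSet_Icc hpt
    calc ω y * (ω z * ‖G y - G z‖ₑ ^ 2)
        ≤ ω y * (ω z * (ENNReal.ofReal (D ^ 2) *
            ∫⁻ τ in Icc (0 : ℝ) 1, φ (z + τ • (y - z)))) := by gcongr
      _ = ENNReal.ofReal (D ^ 2) * ∫⁻ τ in Icc (0 : ℝ) 1, ω y * ω z * φ (z + τ • (y - z)) := by
          rw [lintegral_const_mul (ω y * ω z) hmτ]
          ring
      _ ≤ ENNReal.ofReal (D ^ 2) * (W * ∫⁻ τ in Icc (0 : ℝ) 1, ψ (z + τ • (y - z))) :=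
          mul_le_mul_right hI _
      _ = ENNReal.ofReal (D ^ 2) * W * ∫⁻ τ in Icc (0 : ℝ) 1, ψ (z + τ • (y - z)) :=
          (mul_assoc _ _ _).symm
  -- Step 4: integrate, move the `τ` integral out (Tonelli) and bound each `τ`-slice
  have hωtop : ∀ x, ω x ≠ ∞ := fun x => ne_top_of_le_ne_top hW (hωW x)
  have h3 : ∫⁻ y in Q, ω y * ∫⁻ z in Q, ω z * ‖G y - G z‖ₑ ^ 2 ∂μ ∂μ ≤
      ∫⁻ y in Q, ∫⁻ z in Q, (ENNReal.ofReal (D ^ 2) * W *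
        ∫⁻ τ in Icc (0 : ℝ) 1, ψ (z + τ • (y - z))) ∂μ ∂μ := by
    refine setLIntegral_mono' hQm fun y hy => ?_
    rw [← lintegral_const_mul' _ _ (hωtop y)]
    exact setLIntegral_mono' hQm fun z hz => hseg y hy z hz
  have hmeasI : ∀ y : E, Measurable (uncurry fun (z : E) (τ : ℝ) => ψ (z + τ • (y - z))) :=
    fun y => hψm.comp (by fun_prop)
  have hmeasO : Measurable (uncurry fun (p : E × ℝ) (z : E) => ψ (z + p.2 • (p.1 - z))) :=
    hψm.comp (by fun_prop)
  have hin' : ∀ y, ∫⁻ z in Q, (ENNReal.ofReal (D ^ 2) * W *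
      ∫⁻ τ in Icc (0 : ℝ) 1, ψ (z + τ • (y - z))) ∂μ =
      ENNReal.ofReal (D ^ 2) * W *
        ∫⁻ τ in Icc (0 : ℝ) 1, (∫⁻ z in Q, ψ (z + τ • (y - z)) ∂μ) := by
    intro y
    rw [lintegral_const_mul' _ _ (ENNReal.mul_ne_top ENNReal.ofReal_ne_top hW),
      lintegral_lintegral_swap (hmeasI y).aemeasurable]
  have hout : Measurable fun p : E × ℝ => ∫⁻ z in Q, ψ (z + p.2 • (p.1 - z)) ∂μ :=
    hmeasO.lintegral_prod_right
  have h4 : ∫⁻ y in Q, ∫⁻ z in Q, (ENNReal.ofReal (D ^ 2) * W *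
        ∫⁻ τ in Icc (0 : ℝ) 1, ψ (z + τ • (y - z))) ∂μ ∂μ =
      ENNReal.ofReal (D ^ 2) * W * ∫⁻ τ in Icc (0 : ℝ) 1,
        (∫⁻ y in Q, ∫⁻ z in Q, ψ (z + τ • (y - z)) ∂μ ∂μ) := by
    rw [lintegral_congr fun y => hin' y,
      lintegral_const_mul' _ _ (ENNReal.mul_ne_top ENNReal.ofReal_ne_top hW),
      lintegral_lintegral_swap hout.aemeasurable]
  have h5 : ∫⁻ τ in Icc (0 : ℝ) 1, (∫⁻ y in Q, ∫⁻ z in Q, ψ (z + τ • (y - z)) ∂μ ∂μ) ≤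
      ENNReal.ofReal (2 ^ finrank ℝ E) * μ Q * ∫⁻ w in Q, ψ w ∂μ := by
    have heq : ∀ (τ : ℝ) (y z : E), z + τ • (y - z) = y + (1 - τ) • (z - y) :=
      fun τ y z => by module
    calc ∫⁻ τ in Icc (0 : ℝ) 1, (∫⁻ y in Q, ∫⁻ z in Q, ψ (z + τ • (y - z)) ∂μ ∂μ)
        ≤ ∫⁻ _ in Icc (0 : ℝ) 1,
            (ENNReal.ofReal (2 ^ finrank ℝ E) * μ Q * ∫⁻ w in Q, ψ w ∂μ) := by
          refine setLIntegral_mono' measurableSet_Icc fun τ hτ => ?_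
          simp_rw [heq τ]
          exact setLIntegral_setLIntegral_comp_segment_le μ hψm hQ hQm
            (by linarith [hτ.2]) (by linarith [hτ.1])
      _ = _ := by rw [setLIntegral_const, Real.volume_Icc]; simp
  -- `∫_Q ψ dμ = ∫ φ dν`
  have hψν : ∫⁻ w in Q, ψ w ∂μ = ∫⁻ y, φ y ∂ν := by
    rw [hν, lintegral_withDensity_eq_lintegral_mul μ hωm hφm]
    exact setLIntegral_eq_of_support_subset fun w hw => hsupp fun h0 => hw (by simp [hψ, h0])
  -- assemble
  calc ∫⁻ y, ‖G y - ⨍ z, G z ∂ν‖ₑ ^ 2 ∂ν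
      ≤ (ν univ)⁻¹ * (ENNReal.ofReal (D ^ 2) * W *
          (ENNReal.ofReal (2 ^ finrank ℝ E) * μ Q * ∫⁻ w in Q, ψ w ∂μ)) := by
        refine h1.trans ?_
        rw [h2]
        gcongr
        exact h3.trans (h4.le.trans (by gcongr))
    _ = ENNReal.ofReal (2 ^ finrank ℝ E * D ^ 2) * W * μ Q * (∫⁻ x, ω x ∂μ)⁻¹ *
          ∫⁻ y, φ y ∂ν := by
        rw [ENNReal.ofReal_mul (by positivity), hψν, hνuniv]
        ring

end Literature.Analysis.FunctionSpaces
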